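import Literature.MathematicalPhysics.QuantumFieldTheory.BalabanImbrieJaffe1984to88.BIJ88Ineq5144EndPolyDecay
import Literature.MathematicalPhysics.QuantumFieldTheory.BalabanImbrieJaffe1984to88.BIJ88Ineq5144EndChainCT
import Literature.MathematicalPhysics.QuantumFieldTheory.BalabanImbrieJaffe1984to88.BIJ88EndChainNFluctSource309

/-!
# `BalabanImbrieJaffe1984to88.BIJ88Ineq5144EndChainNSource` — T. Bałaban, J. Imbrie, A. Jaffe, *Effective action and cluster properties of the
abelian Higgs model*, Commun. Math. Phys. **114** (1988) 257–315 [BalabanImbrieJaffe1988], Sect. 5.14 (5.14.4) p. 309–310 [PDF 53–54] with Sect.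
5.13 p. 305–307 [PDF 49–51] and [Balaban1982Higgs2] (2.28)–(2.29) p. 563: **(5.14.4), LOCATED, ON END-DECORATED CHAINS OF EVERY LENGTH WITH
SOURCES — SIZE-UNIFORM** — `BIJ88Ineq5144EndChainNDecay` (sourceless class) extended to the §5.13 Gaussian measures WITH THEIR LINEAR SOURCE `ℱ`
(the background term; the head of row C2.Eq5.14.5 quantifies over it; owner r16 2026-08-23T08:47Z: *«what would widen the flip item's class next,
in value order: (1) ℱ ≠ 0 with a displayed mean-field/drift letter …»*).  THE CLASS: the §5.13 model; the polymer `X″ ∋ a, b, n` (pairwise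
distinct), `□_a` decorated by interaction slots only, every other cube of `X″` slot-free, `□_b` the only cube of `X″ ∖ {a}` coupled to `□_a`; ANY
source with `|ℱ_x| ≤ F`.  THE LETTERS: (b) pointwise decay of the restricted interpolated inverse `|((Δ_{1_{Λ′}})_s↾Λ)⁻¹(x,l)| ≤ c₁δ^{d(x,l)}`;
**(c) THE DRIFT / MEAN-FIELD LETTER**: absolute row sums of the restricted and of the full interpolated inverse `≤ c₂` (so the drift
`d = A_Λ⁻¹ℱ↾Λ` and the mean `m = A⁻¹ℱ` obey `|d_x|, |m_k| ≤ c₂F`; print p. 305: *"an exponentially decaying covariance C_s"* — bounded on `ℓ^∞`),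
both uniform in `s ∈ [0,1]^I` supported in `X″`; W, R, F; clause (ii); the V-half of the vacuum clause; `0 ≤ t ≤ 1`; the depth clause `d(x,l) ≥
|X″| − 2`; and the TWO SIZE-FREE REGIME CLAUSES (`ρ₁ = W·c₁δ·R`, `μ = 1/m + (c₂F)²`)

  `4·W·R·ρ₁·(ρ₁·μ + c₂F·(1 + μ)) ≤ θ^{β′}`      and      `2δ ≤ θ^{β′}`

— FIRST order in `δ` per cube crossed (with a source the far cube's fluctuation is linear in the boundary rows; print p. 310: *"The others,
localized in region X, have a factor of e^{−cr(e_k)|X|}"*); they give the `N`-cube regime inequality for EVERY `N ≥ 3` (`regime_chainN_source`).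
CONCLUSION: `|locAct (□∘γ) g₃ (H, X″)| ≤ θ^{|H| + β′·|X″ ∖ □(γ(H))|}` (`ineq5144_locAct_endChainN_source_of_decay`); and the same with (b), (c),
`c₁, c₂, δ, ds`, the depth clause REPLACED by `Δ`-letters through Combes–Thomas (range `1` in `d`, `|Δ_{xy}| ≤ h`, `≤ z` neighbours, rate `μ`
with `h z(e^μ − 1) ≤ m/2`, THE SUMMABILITY LETTER `Σ_y e^{−μ d(x,y)} ≤ Z₀`, unit `ℓ > 0`, face clause `(|X″| − 2)·ℓ ≤ d(x,l)`; `c₁ = 2/m`,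
`δ = e^{−μℓ}`, `c₂ = (2/m)·Z₀`) (`ineq5144_locAct_endChainN_source_of_combesThomas`).  θ-ACCOUNTING as in `BIJ88Ineq5144EndChainNDecay` with `δ`
(not `δ²`) per cube crossed; same DECLARED BOOKKEEPING DIVERGENCE (`□_b` from (ii) / vacuum) and DIVERGENCE OF METHOD (one conditioned
`s_n`-derivative).

statement-level skeleton of published theorems with citation tags; proofs where landed; nothing here is a claim about the Yang–Mills mass gap

PDF held: `paper:balaban1988-cmp114-bij-abelian-higgs-effective-action` (journal page = PDF page + 256); p. 309 (p0053 L14–16) (5.14.4), p. 305 (p0049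
L17–18), p. 307 (p0051), p. 310 (p0054) as quoted here and in `BIJ88Ineq5144EndChainDecay`.

WHAT IS PROVED (unit `lit-balaban-p36`, generation 20 of the Phase-2 proof seat p36; SKELETON rows C2.Eq5.14.3-5.14.4 (flip item; class widened
to end-decorated chains of every length WITH SOURCES) / C2.Eq5.13.3-5.13.4 of `HOME/lit-balaban-r16/ROWS-C2-part2.md`, owner r16; 0 definitions,
0 `Prop` facts): `regime_chainN_source`, `interp_inv_decay` (Combes–Thomas for the FULL interpolated inverse), `sum_subtype_le_sum`,
**`ineq5144_locAct_endChainN_source_of_decay`**, **`ineq5144_locAct_endChainN_source_of_combesThomas`**.  HONEST SCOPE: end-decorated CHAINS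
with sources; χ-decorated cubes and middle decorations NOT covered.  Imports `BIJ88Ineq5144EndPolyDecay`, `BIJ88Ineq5144EndChainCT` (p36 g19),
`BIJ88EndChainNFluctSource309` (p36 g20); modifies nothing.  NOT summit progress; NOT continuum; NOT Clay.  Cell `lit-balaban` Phase 2, seat p36
gen 20 (owner r16, referee ref-5).
-/

noncomputable section

open Finset MeasureTheory Matrix Function Filter
open Literature.Analysis.OperatorTheory (combesThomas_banded)
open Literature.MathematicalPhysics.QuantumFieldTheory.Balaban1983to89
open Literature.MathematicalPhysics.QuantumFieldTheory.BalabanImbrieJaffe1984to88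
open B2Eq228Conditioning (In Out resIn resOut glue blkIn blkMix condShift)
open BIJ88Sect5Statements (CutoffProfile)
open BIJ88DirichletForms305 (interpForm interpForm_posDef quadForm_interpForm_ge)
open BIJ88PolymerRep5134 (corner)
open BIJ88PolymerRep5134GaussWitness (corner_mem_cube)
open BIJ88Expansion5143Gauss (fD fD_local)
open BIJ88SlotMomentsGauss308 (uD)
open BIJ88SlotConnectedGraph310 (uD_local)
open BIJ88Eq5145CornerModel (slotB slotY)
open BIJ88Eq5145CornerUrsell (cubeIn)
open BIJ88W6PrimeVsupp (actIn)
open BIJ88Ineq5144Located (locAct locAct_of_loc locAct_of_not_loc)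
open BIJ88SecondOrder5133 (num Dfun)
open BIJ88ActInFarCube309 (abs_actIn_le_of_condMean_fluct)
open BIJ88EndChainFluct309 (exists_quadForm_le abs_interpForm_apply_le)
open BIJ88EndChainNFluctSource309 (fluct_le_chainN_source)
open BIJ88Ineq5144EndChainDecay (fD_eq_one_of_free measurable_fD_of_inr abs_fD_le_of_inr abs_fD_empty_sub_one_le)
open BIJ88Ineq5144EndPolyDecay (bookkeeping_nonempty_poly bookkeeping_empty_poly)
open BIJ88Ineq5144EndChainCT (restricted_inv_decay restricted_inv_decay_pow mulVec_inv_col)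

namespace Literature.MathematicalPhysics.QuantumFieldTheory.BalabanImbrieJaffe1984to88.BIJ88Ineq5144EndChainNSource

/-! ## §1 The size-free regime clauses with a source -/

/-- **the two size-free clauses imply the `N`-cube regime inequality for every `N = k + 3 ≥ 3`** (source case, first order in `δ` per cube):
`2^{N−1}·W·R·ρ_N(ρ_Nμ + c₂F(1+μ)) ≤ (4WRρ₁(ρ₁μ + c₂F(1+μ)))·(2δ)^{N−3} ≤ θ^{β′(N−2)}` (`ρ_N = Wc₁δ^{N−2}R ≤ ρ₁δ^{N−3}`).
[cite: BalabanImbrieJaffe1988, (5.14.4) p.309–310] -/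
theorem regime_chainN_source {W R c₁ δ m c₂ F θ β' : ℝ} (hW : 0 ≤ W) (hR : 0 ≤ R) (hc₁ : 0 ≤ c₁) (hδ0 : 0 ≤ δ) (hδ1 : δ ≤ 1) (hm : 0 < m)
    (hc₂ : 0 ≤ c₂) (hF : 0 ≤ F) (hθ0 : 0 < θ)
    (hreg : 4 * (W * R * ((W * (c₁ * δ * R)) * ((W * (c₁ * δ * R)) * (m⁻¹ + (c₂ * F) ^ 2) + c₂ * F * (1 + (m⁻¹ + (c₂ * F) ^ 2))))) ≤
      θ ^ β')
    (hstep : 2 * δ ≤ θ ^ β') (k : ℕ) :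
    (2 : ℝ) ^ (k + 2) * (W * R * ((W * (c₁ * δ ^ (k + 1) * R)) * ((W * (c₁ * δ ^ (k + 1) * R)) * (m⁻¹ + (c₂ * F) ^ 2) +
        c₂ * F * (1 + (m⁻¹ + (c₂ * F) ^ 2))))) ≤ θ ^ (β' * ((k : ℝ) + 1)) := by
  have hμ0 : 0 ≤ m⁻¹ + (c₂ * F) ^ 2 := by positivity
  -- the bracket only decreases with the depth
  have hδk : δ ^ (k + 1) ≤ δ := by
    calc δ ^ (k + 1) ≤ δ ^ 1 := pow_le_pow_of_le_one hδ0 hδ1 (by omega)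
      _ = δ := pow_one δ
  have hB : (W * (c₁ * δ ^ (k + 1) * R)) * (m⁻¹ + (c₂ * F) ^ 2) + c₂ * F * (1 + (m⁻¹ + (c₂ * F) ^ 2)) ≤
      (W * (c₁ * δ * R)) * (m⁻¹ + (c₂ * F) ^ 2) + c₂ * F * (1 + (m⁻¹ + (c₂ * F) ^ 2)) := by
    have h1 : W * (c₁ * δ ^ (k + 1) * R) ≤ W * (c₁ * δ * R) :=
      mul_le_mul_of_nonneg_left (mul_le_mul_of_nonneg_right (mul_le_mul_of_nonneg_left hδk hc₁) hR) hW
    linarith [mul_le_mul_of_nonneg_right h1 hμ0]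
  -- the geometric part
  have hG : ∀ k : ℕ, (2 : ℝ) ^ (k + 2) * (W * R * ((W * (c₁ * δ ^ (k + 1) * R)) *
      ((W * (c₁ * δ * R)) * (m⁻¹ + (c₂ * F) ^ 2) + c₂ * F * (1 + (m⁻¹ + (c₂ * F) ^ 2))))) ≤ θ ^ (β' * ((k : ℝ) + 1)) := by
    intro k
    induction k with
    | zero =>
      have h0 : (2 : ℝ) ^ (0 + 2) * (W * R * ((W * (c₁ * δ ^ (0 + 1) * R)) *
          ((W * (c₁ * δ * R)) * (m⁻¹ + (c₂ * F) ^ 2) + c₂ * F * (1 + (m⁻¹ + (c₂ * F) ^ 2))))) =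
          4 * (W * R * ((W * (c₁ * δ * R)) * ((W * (c₁ * δ * R)) * (m⁻¹ + (c₂ * F) ^ 2) + c₂ * F * (1 + (m⁻¹ + (c₂ * F) ^ 2))))) := by
        norm_num
      rw [h0, Nat.cast_zero, zero_add, mul_one]
      exact hreg
    | succ k ih =>
      have h1 : (2 : ℝ) ^ (k + 1 + 2) * (W * R * ((W * (c₁ * δ ^ (k + 1 + 1) * R)) *
          ((W * (c₁ * δ * R)) * (m⁻¹ + (c₂ * F) ^ 2) + c₂ * F * (1 + (m⁻¹ + (c₂ * F) ^ 2))))) =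
          (2 * δ) * ((2 : ℝ) ^ (k + 2) * (W * R * ((W * (c₁ * δ ^ (k + 1) * R)) *
            ((W * (c₁ * δ * R)) * (m⁻¹ + (c₂ * F) ^ 2) + c₂ * F * (1 + (m⁻¹ + (c₂ * F) ^ 2)))))) := by ring
      have h0 : 0 ≤ (2 : ℝ) ^ (k + 2) * (W * R * ((W * (c₁ * δ ^ (k + 1) * R)) *
          ((W * (c₁ * δ * R)) * (m⁻¹ + (c₂ * F) ^ 2) + c₂ * F * (1 + (m⁻¹ + (c₂ * F) ^ 2))))) := by positivity
      rw [h1, Nat.cast_succ, show β' * ((k : ℝ) + 1 + 1) = β' + β' * ((k : ℝ) + 1) by ring, Real.rpow_add hθ0]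
      exact mul_le_mul hstep ih h0 (Real.rpow_nonneg hθ0.le _)
  have hρ0 : 0 ≤ W * (c₁ * δ ^ (k + 1) * R) := by positivity
  calc _ ≤ (2 : ℝ) ^ (k + 2) * (W * R * ((W * (c₁ * δ ^ (k + 1) * R)) *
        ((W * (c₁ * δ * R)) * (m⁻¹ + (c₂ * F) ^ 2) + c₂ * F * (1 + (m⁻¹ + (c₂ * F) ^ 2))))) :=
      mul_le_mul_of_nonneg_left (mul_le_mul_of_nonneg_left (mul_le_mul_of_nonneg_left hB hρ0) (mul_nonneg hW hR))
        (pow_nonneg (by norm_num) _)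
    _ ≤ _ := hG k

/-! ## §2 Combes–Thomas for the full interpolated inverse; summable decay gives the row-sum letter (c) -/

section CT

variable {α I : Type} [Fintype α] [DecidableEq α] [Fintype I] [DecidableEq I] (blk : α → I) {Δ : Matrix α α ℝ}

/-- **the FULL interpolated inverse decays like the restricted one**: `|((Δ_{1_{Λ′}})_s)⁻¹(x,l)| ≤ (2/m)·e^{−μ d(x,l)}` under the `Δ`-letters of
`BIJ88Ineq5144EndChainCT.restricted_inv_decay` (p. 305: *"an exponentially decaying covariance C_s = (−Δ_s)⁻¹"*).
[cite: BalabanImbrieJaffe1988, §5.13 p.305] [cite: CombesThomas1973, §II] -/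
theorem interp_inv_decay (d : α → α → ℝ) (hd0 : ∀ i, d i i = 0) (hdsymm : ∀ i k, d i k = d k i) (hdtri : ∀ i j k, d i k ≤ d i j + d j k)
    (hband : ∀ x y, 1 < d x y → Δ x y = 0) {h : ℝ} (hh0 : 0 ≤ h) (hh : ∀ x y, x ≠ y → |Δ x y| ≤ h)
    {z : ℝ} (hz : ∀ x, ((univ.filter fun y => y ≠ x ∧ d x y ≤ 1).card : ℝ) ≤ z)
    (hΔ : Δ.PosDef) {m : ℝ} (hm : 0 < m) (hΔm : ∀ φ : α → ℝ, m * (φ ⬝ᵥ φ) ≤ φ ⬝ᵥ (Δ *ᵥ φ))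
    {μ : ℝ} (hμ : 0 ≤ μ) (hsmall : h * z * (Real.exp μ - 1) ≤ m / 2)
    (Λc : Finset I) {s : I → ℝ} (hs : ∀ l, 0 ≤ s l ∧ s l ≤ 1) (x l : α) :
    |(interpForm blk (interpForm blk Δ (corner ℝ Λc)) s)⁻¹ x l| ≤ 2 / m * Real.exp (-(μ * d x l)) := by
  have hcs := corner_mem_cube (I := I) Λc
  have hΔc : (interpForm blk Δ (corner ℝ Λc)).PosDef := interpForm_posDef blk hΔ hcs
  have hA : (interpForm blk (interpForm blk Δ (corner ℝ Λc)) s).PosDef := interpForm_posDef blk hΔc hs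
  have hmA : ∀ v : α → ℝ, m * (v ⬝ᵥ v) ≤ v ⬝ᵥ (interpForm blk (interpForm blk Δ (corner ℝ Λc)) s *ᵥ v) :=
    quadForm_interpForm_ge blk (quadForm_interpForm_ge blk hΔm hcs) hs
  have hent : ∀ i k, |interpForm blk (interpForm blk Δ (corner ℝ Λc)) s i k| ≤ |Δ i k| := fun i k =>
    (abs_interpForm_apply_le blk _ hs _ _).trans (abs_interpForm_apply_le blk Δ hcs _ _)
  refine combesThomas_banded (interpForm blk (interpForm blk Δ (corner ℝ Λc)) s) d m h z μ hm hμ hd0 hdsymm hdtri (fun i k hik => ?_) hh0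
    (fun i k hik => (hent i k).trans (hh _ _ hik)) hz hmA hsmall l (fun i => (interpForm blk (interpForm blk Δ (corner ℝ Λc)) s)⁻¹ i l)
    (mulVec_inv_col _ (isUnit_iff_ne_zero.2 hA.det_pos.ne') l) x
  exact abs_eq_zero.1 (le_antisymm ((hent i k).trans (le_of_eq (by rw [hband _ _ hik, abs_zero]))) (abs_nonneg _))

omit [DecidableEq α] [Fintype I] [DecidableEq I] in
/-- a nonnegative site sum over `Λ` is at most the sum over all sites. [folklore] [cite: BalabanImbrieJaffe1988, §5.13 p.305] -/
theorem sum_subtype_le_sum (P : α → Prop) [DecidablePred P] (g : α → ℝ) (hg : ∀ y, 0 ≤ g y) : ∑ l : In P, g l.1 ≤ ∑ y, g y := by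
  calc ∑ l : In P, g l.1 = ∑ y ∈ (univ : Finset (In P)).map (Embedding.subtype _), g y := by rw [sum_map]; rfl
    _ ≤ ∑ y, g y := sum_le_sum_of_subset_of_nonneg (subset_univ _) fun _ _ _ => hg _

end CT

/-! ## §3 (5.14.4), located, on end-decorated chains of every length with sources -/

section Main

variable {α I : Type} [Fintype α] [DecidableEq α] [Fintype I] [DecidableEq I] (blk : α → I) (Δ : Matrix α α ℝ) (ℱ : α → ℝ)
variable (adj : I → I → Prop) [DecidableRel adj]
variable (χ : CutoffProfile) {ι υ : Type} [DecidableEq ι] [DecidableEq υ]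
variable (p ek : ℝ) (B : Finset ι) (Φ : ι → (α → ℝ) → ℝ) (c : ι → ℝ) (Ys : Finset υ) (V : υ → (α → ℝ) → ℝ)
variable (cube : ↥B ⊕ ↥Ys → I)

/-- **(5.14.4) LOCATED ON AN END-DECORATED CHAIN OF ANY LENGTH WITH A SOURCE, SIZE-UNIFORM CLAUSES** — see the module docstring for the class,
the letters (b), (c), F and the two clauses; `X″ ∋ a, b, n` pairwise distinct, `□_a` decorated (interaction slots only), every other cube of `X″`
slot-free, `□_b` the only cube of `X″ ∖ {a}` coupled to `□_a`, depth clause `ds ≥ |X″| − 2`, `Λ = {x | □x ≠ a}`, `Λ′` the corner of the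
precision. [cite: BalabanImbrieJaffe1988, (5.14.4) p.309–310; p.305, p.307 (Sect. 5.13)] [cite: Balaban1982Higgs2, (2.29) p.563] -/
theorem ineq5144_locAct_endChainN_source_of_decay [Fintype ι] [Fintype υ]
    (hΔ : Δ.PosDef) {m : ℝ} (hm : 0 < m) (hΔm : ∀ φ : α → ℝ, m * (φ ⬝ᵥ φ) ≤ φ ⬝ᵥ (Δ *ᵥ φ))
    (hΦloc : ∀ b : B, ∀ φ ψ : α → ℝ, (∀ x, blk x = cube (Sum.inl b) → φ x = ψ x) → Φ b φ = Φ b ψ)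
    (hVloc : ∀ Y : Ys, ∀ φ ψ : α → ℝ, (∀ x, blk x = cube (Sum.inr Y) → φ x = ψ x) → V Y φ = V Y ψ)
    (hV : ∀ Y ∈ Ys, Measurable (V Y)) {KY : υ → ℝ} (hK : ∀ Y ∈ Ys, ∀ φ, |V Y φ| ≤ KY Y)
    {K₁ : ℝ} (hK₁0 : 0 ≤ K₁) (hK₁ : ∀ Y ∈ Ys, KY Y ≤ K₁) {G : ℕ} (hG : ∀ i, (univ.filter fun τ : ↥B ⊕ ↥Ys => cube τ = i).card ≤ G)
    {θ β' : ℝ} (hθ0 : 0 < θ) (hθ1 : θ ≤ 1) (hβ : 0 ≤ β')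
    (hvac : Real.exp (2 * G * K₁) - 1 ≤ θ ^ (2 * β') / 2) (hKθ₂ : ∀ Y ∈ Ys, KY Y * Real.exp (2 * G * K₁) ≤ θ ^ (1 + β') / 2)
    -- the geometry letters W (sites per cube) and R (off-diagonal row sums of `Δ`), the source letter F
    {W : ℕ} (hW : ∀ i, (univ.filter fun x : α => blk x = i).card ≤ W)
    {R : ℝ} (hR0 : 0 ≤ R) (hR : ∀ x, ∑ y ∈ univ.filter (fun y => blk y ≠ blk x), |Δ x y| ≤ R)
    {F : ℝ} (hF0 : 0 ≤ F) (hF : ∀ x, |ℱ x| ≤ F)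
    -- the class: the end-decorated chain `X″ = a – b – ⋯ – n`
    (X'' : Finset I) {a b n : I} (haX : a ∈ X'') (hbX : b ∈ X'') (hnX : n ∈ X'') (hab : a ≠ b) (han : a ≠ n) (hbn : b ≠ n)
    (haV : ∀ b' : ↥B, cube (Sum.inl b') ≠ a) (hfree : ∀ τ : ↥B ⊕ ↥Ys, cube τ ∈ X'' → cube τ = a)
    (hnbr : ∀ l k, blk l ∈ X'' → blk l ≠ a → blk k = a → Δ l k ≠ 0 → blk l = b)
    -- the decay letter (b), the row-sum letter (c), the chain's depth, the two size-free regime clauses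
    (ds : α → α → ℕ) {c₁ δ : ℝ} (hc₁ : 0 ≤ c₁) (hδ0 : 0 ≤ δ) (hδ1 : δ ≤ 1)
    (hgeo : ∀ x l, (blk x = n ∨ (blk x ∈ X'' ∧ ∃ y, blk y = n ∧ Δ y x ≠ 0)) → blk l = b → (∃ k, blk k = a ∧ Δ l k ≠ 0) →
      X''.card - 2 ≤ ds x l)
    (Λc X : Finset I)
    (hdec : ∀ s : I → ℝ, (∀ l, 0 ≤ s l ∧ s l ≤ 1) → (∀ l, l ∉ X'' → s l = 0) →
      ∀ x l : In (fun x => blk x ≠ a),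
        |(blkIn (fun x => blk x ≠ a) (interpForm blk (interpForm blk Δ (corner ℝ Λc)) s))⁻¹ x l| ≤ c₁ * δ ^ ds x.1 l.1)
    {c₂ : ℝ} (hc₂ : 0 ≤ c₂)
    (hrowΛ : ∀ s : I → ℝ, (∀ l, 0 ≤ s l ∧ s l ≤ 1) → (∀ l, l ∉ X'' → s l = 0) →
      ∀ x : In (fun x => blk x ≠ a), ∑ l, |(blkIn (fun x => blk x ≠ a) (interpForm blk (interpForm blk Δ (corner ℝ Λc)) s))⁻¹ x l| ≤ c₂)
    (hrowA : ∀ s : I → ℝ, (∀ l, 0 ≤ s l ∧ s l ≤ 1) → (∀ l, l ∉ X'' → s l = 0) →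
      ∀ k, blk k = a → ∑ l, |(interpForm blk (interpForm blk Δ (corner ℝ Λc)) s)⁻¹ k l| ≤ c₂)
    (hreg : 4 * (W * R * ((W * (c₁ * δ * R)) * ((W * (c₁ * δ * R)) * (m⁻¹ + (c₂ * F) ^ 2) + c₂ * F * (1 + (m⁻¹ + (c₂ * F) ^ 2))))) ≤
      θ ^ β')
    (hstep : 2 * δ ≤ θ ^ β')
    {t : ℝ} (ht0 : 0 ≤ t) (ht1 : t ≤ 1) {L : Type} [DecidableEq L] (γ : L → ↥(slotB B Ys cube X) ⊕ ↥(slotY B Ys cube X)) (H : Finset L) :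
    |locAct (cubeIn cube X ∘ γ) (actIn blk Δ ℱ adj χ p ek B Φ c Ys V cube Λc X t γ) H X''| ≤
      θ ^ ((H.card : ℝ) + β' * ((X'' \ H.image (cubeIn cube X ∘ γ)).card : ℝ)) := by
  by_cases hloc : ∀ j ∈ H, (cubeIn cube X ∘ γ) j ∈ X''
  swap
  · rw [locAct_of_not_loc hloc, abs_zero]
    exact Real.rpow_nonneg hθ0.le _
  rw [locAct_of_loc hloc]
  -- the chain has at least the three cubes `a, b, n`
  have h3 : 3 ≤ X''.card := by
    have hc : ({a, b, n} : Finset I).card = 3 := by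
      rw [card_insert_of_notMem (by simp only [mem_insert, mem_singleton, not_or]; exact ⟨hab, han⟩), card_pair hbn]
    exact hc ▸ card_le_card (insert_subset haX (insert_subset hbX (singleton_subset_iff.2 hnX)))
  have h2 : 2 ≤ X''.card := by omega
  -- `□_n` is far: a site of `□_n` coupled to `□_a` would lie in `□_b`
  have hfar : ∀ x y, blk x = n → blk y = a → Δ x y = 0 := fun x y hx hy => by
    by_contra h
    exact hbn ((hnbr x y (hx ▸ hnX) (fun h' => han (h'.symm.trans hx)) hy h).symm.trans hx)
  -- every slot located in the polymer sits at `□_a`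
  have hslot : ∀ τ : ↥(slotB B Ys cube X) ⊕ ↥(slotY B Ys cube X), cubeIn cube X τ ∈ X'' → cubeIn cube X τ = a := fun τ hτ => by
    rcases τ with b' | Y <;> exact hfree _ hτ
  have hHa : ∀ j ∈ H, cubeIn cube X (γ j) = a := fun j hj => hslot _ (hloc j hj)
  have hfreei : ∀ i ∈ X'', i ≠ a → ∀ τ : ↥B ⊕ ↥Ys, cube τ ≠ i := fun i hi hia τ hτ =>
    hia ((hfree τ (hτ ▸ hi)).symm.trans hτ).symm
  -- the observable of the polymer is the decorated cube's
  have hprod : ∀ ψ : α → ℝ, ∏ i ∈ X'',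
      fD (uD χ p ek (slotB B Ys cube X) (fun b : ↥B => Φ b) (fun b : ↥B => c b) (slotY B Ys cube X) (fun Y : ↥Ys => V Y) t)
        (cubeIn cube X) γ H i ψ =
      fD (uD χ p ek (slotB B Ys cube X) (fun b : ↥B => Φ b) (fun b : ↥B => c b) (slotY B Ys cube X) (fun Y : ↥Ys => V Y) t)
        (cubeIn cube X) γ H a ψ := fun ψ =>
    prod_eq_single_of_mem a haX fun i hi hia => fD_eq_one_of_free χ p ek B Φ c Ys V cube X t γ (hfreei i hi hia) H ψ
  -- the engine's hypotheses
  have hcs := corner_mem_cube (I := I) Λc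
  have hΔc : (interpForm blk Δ (corner ℝ Λc)).PosDef := interpForm_posDef blk hΔ hcs
  have hmΔc : ∀ φ : α → ℝ, m * (φ ⬝ᵥ φ) ≤ φ ⬝ᵥ (interpForm blk Δ (corner ℝ Λc) *ᵥ φ) := quadForm_interpForm_ge blk hΔm hcs
  obtain ⟨Cu, hCu⟩ := exists_quadForm_le (interpForm blk Δ (corner ℝ Λc))
  have hf : ∀ i (φ ψ : α → ℝ), (∀ x, blk x = i → φ x = ψ x) →
      fD (uD χ p ek (slotB B Ys cube X) (fun b : ↥B => Φ b) (fun b : ↥B => c b) (slotY B Ys cube X) (fun Y : ↥Ys => V Y) t)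
        (cubeIn cube X) γ H i φ =
      fD (uD χ p ek (slotB B Ys cube X) (fun b : ↥B => Φ b) (fun b : ↥B => c b) (slotY B Ys cube X) (fun Y : ↥Ys => V Y) t)
        (cubeIn cube X) γ H i ψ := fun i φ ψ h =>
    fD_local blk γ (uD_local blk χ (cubeIn cube X) (fun b' φ ψ h => hΦloc b'.1 φ ψ h) (fun Y φ ψ h => hVloc Y.1 φ ψ h) t) H i φ ψ h
  have hfm : Measurable fun ψ : α → ℝ => ∏ i ∈ X'',
      fD (uD χ p ek (slotB B Ys cube X) (fun b : ↥B => Φ b) (fun b : ↥B => c b) (slotY B Ys cube X) (fun Y : ↥Ys => V Y) t)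
        (cubeIn cube X) γ H i ψ := by
    rw [show (fun ψ : α → ℝ => ∏ i ∈ X'',
        fD (uD χ p ek (slotB B Ys cube X) (fun b : ↥B => Φ b) (fun b : ↥B => c b) (slotY B Ys cube X) (fun Y : ↥Ys => V Y) t)
          (cubeIn cube X) γ H i ψ) = fun ψ =>
        fD (uD χ p ek (slotB B Ys cube X) (fun b : ↥B => Φ b) (fun b : ↥B => c b) (slotY B Ys cube X) (fun Y : ↥Ys => V Y) t)
          (cubeIn cube X) γ H a ψ from funext hprod]
    exact measurable_fD_of_inr χ p ek B Φ c Ys V cube X t γ haV hV H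
  have hlocP : ∀ φ ψ : α → ℝ, (∀ x, ¬ (fun x => blk x ≠ a) x → φ x = ψ x) →
      (∏ i ∈ X'',
        fD (uD χ p ek (slotB B Ys cube X) (fun b : ↥B => Φ b) (fun b : ↥B => c b) (slotY B Ys cube X) (fun Y : ↥Ys => V Y) t)
          (cubeIn cube X) γ H i φ) =
      ∏ i ∈ X'',
        fD (uD χ p ek (slotB B Ys cube X) (fun b : ↥B => Φ b) (fun b : ↥B => c b) (slotY B Ys cube X) (fun Y : ↥Ys => V Y) t)
          (cubeIn cube X) γ H i ψ := fun φ ψ h => by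
    rw [hprod, hprod]
    exact hf a φ ψ fun x hx => h x (not_ne_iff.2 hx)
  have hPn : ∀ x, blk x = n → (fun x => blk x ≠ a) x := fun x hx h => han (h.symm.trans hx)
  have hfar' : ∀ x y, blk x = n → ¬ (fun x => blk x ≠ a) y → Δ x y = 0 := fun x y hx hy => hfar x y hx (not_ne_iff.1 hy)
  have hM0 : 0 ≤ W * R * ((W * (c₁ * δ ^ (X''.card - 2) * R)) * ((W * (c₁ * δ ^ (X''.card - 2) * R)) * (m⁻¹ + (c₂ * F) ^ 2) +
      c₂ * F * (1 + (m⁻¹ + (c₂ * F) ^ 2)))) := by positivity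
  -- the size-free clauses give the `N`-cube regime inequality
  have hregN : 2 ^ (X''.card - 1) * (W * R * ((W * (c₁ * δ ^ (X''.card - 2) * R)) *
      ((W * (c₁ * δ ^ (X''.card - 2) * R)) * (m⁻¹ + (c₂ * F) ^ 2) + c₂ * F * (1 + (m⁻¹ + (c₂ * F) ^ 2))))) ≤
      θ ^ (β' * ((X''.card : ℝ) - 2)) := by
    obtain ⟨k, hk⟩ : ∃ k, X''.card = k + 3 := ⟨X''.card - 3, by omega⟩
    rw [hk, show k + 3 - 1 = k + 2 by omega, show k + 3 - 2 = k + 1 by omega, Nat.cast_add, Nat.cast_ofNat,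
      show β' * ((k : ℝ) + 3 - 2) = β' * ((k : ℝ) + 1) by ring]
    exact regime_chainN_source (Nat.cast_nonneg W) hR0 hc₁ hδ0 hδ1 hm hc₂ hF0 hθ0 hreg hstep k
  have hexpG : Real.exp (G * K₁) ≤ Real.exp (2 * G * K₁) :=
    Real.exp_le_exp.2 (by nlinarith [mul_nonneg (Nat.cast_nonneg G) hK₁0])
  rcases H.eq_empty_or_nonempty with rfl | hHne
  · -- the vacuum chain: `c₀ = 1`, `K₀ = θ^{2β′}/2`
    have hK0 : ∀ ψ : α → ℝ, |(∏ i ∈ X'',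
        fD (uD χ p ek (slotB B Ys cube X) (fun b : ↥B => Φ b) (fun b : ↥B => c b) (slotY B Ys cube X) (fun Y : ↥Ys => V Y) t)
          (cubeIn cube X) γ ∅ i ψ) - 1| ≤ θ ^ (2 * β') / 2 := fun ψ => by
      rw [hprod]
      refine (abs_fD_empty_sub_one_le χ p ek B Φ c Ys V cube X t γ haV hK hK₁0 hK₁ hG ht0 ht1 ψ).trans ?_
      linarith
    have hb := abs_actIn_le_of_condMean_fluct blk Δ ℱ adj χ p ek B Φ c Ys V cube Λc X t γ ∅ h2 hΔc hm hmΔc hCu hf hfm 1 hK0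
      (fun x => blk x ≠ a) hlocP hnX hPn hfar'
      (fun s hs hs0 => fluct_le_chainN_source blk hΔ hm hΔm ℱ hab han X'' hfar hnbr hW hR0 hR ds hc₁ hδ0 hδ1 (X''.card - 2) hgeo Λc
        hs hs0 (hdec s hs hs0) hF0 hF hc₂ (hrowΛ s hs hs0) (hrowA s hs hs0))
    refine hb.trans ?_
    rw [card_empty, image_empty, sdiff_empty]
    push_cast
    exact bookkeeping_empty_poly hθ0 hregN
  · -- the decorated chains: `c₀ = 0`, `K₀ = (θ^{1+β′}/2)^{|H|}`
    have hk : 1 ≤ H.card := by have := card_pos.2 hHne; omega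
    have hκ : ∀ Y ∈ Ys, KY Y ≤ θ ^ (1 + β') / 2 / Real.exp (2 * G * K₁) := fun Y hY =>
      (le_div_iff₀ (Real.exp_pos _)).2 (hKθ₂ Y hY)
    have hθp : 0 ≤ θ ^ (1 + β') / 2 := div_nonneg (Real.rpow_nonneg hθ0.le _) (by norm_num)
    have hκ0 : 0 ≤ θ ^ (1 + β') / 2 / Real.exp (2 * G * K₁) := div_nonneg hθp (Real.exp_pos _).le
    have hE1 : 1 ≤ Real.exp (2 * G * K₁) :=
      Real.one_le_exp (mul_nonneg (mul_nonneg (by norm_num) (Nat.cast_nonneg _)) hK₁0)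
    have hK0 : ∀ ψ : α → ℝ, |(∏ i ∈ X'',
        fD (uD χ p ek (slotB B Ys cube X) (fun b : ↥B => Φ b) (fun b : ↥B => c b) (slotY B Ys cube X) (fun Y : ↥Ys => V Y) t)
          (cubeIn cube X) γ H i ψ) - 0| ≤ (θ ^ (1 + β') / 2) ^ H.card := fun ψ => by
      rw [sub_zero, hprod]
      refine (abs_fD_le_of_inr χ p ek B Φ c Ys V cube X t γ haV hK hK₁0 hK₁ hG ht0 ht1 hκ0 hκ H hHa ψ).trans ?_
      rw [div_pow, div_mul_eq_mul_div, div_le_iff₀ (pow_pos (Real.exp_pos _) _)]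
      exact mul_le_mul_of_nonneg_left (hexpG.trans (le_self_pow₀ hE1 (by omega))) (pow_nonneg hθp _)
    have hb := abs_actIn_le_of_condMean_fluct blk Δ ℱ adj χ p ek B Φ c Ys V cube Λc X t γ H h2 hΔc hm hmΔc hCu hf hfm 0 hK0
      (fun x => blk x ≠ a) hlocP hnX hPn hfar'
      (fun s hs hs0 => fluct_le_chainN_source blk hΔ hm hΔm ℱ hab han X'' hfar hnbr hW hR0 hR ds hc₁ hδ0 hδ1 (X''.card - 2) hgeo Λc
        hs hs0 (hdec s hs hs0) hF0 hF hc₂ (hrowΛ s hs hs0) (hrowA s hs hs0))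
    refine hb.trans ?_
    -- `a ∈ □(γ(H))`, so at most `|X″| − 1` undecorated cubes
    have hcard : ((X'' \ H.image (cubeIn cube X ∘ γ)).card : ℝ) ≤ (X''.card : ℝ) - 1 := by
      obtain ⟨j, hj⟩ := hHne
      have ha : a ∈ H.image (cubeIn cube X ∘ γ) := mem_image.2 ⟨j, hj, hHa j hj⟩
      have hsub : X'' \ H.image (cubeIn cube X ∘ γ) ⊆ X''.erase a := by
        intro i hi
        rw [Finset.mem_sdiff] at hi
        exact mem_erase.2 ⟨fun h => hi.2 (h ▸ ha), hi.1⟩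
      have hc : (X'' \ H.image (cubeIn cube X ∘ γ)).card + 1 ≤ X''.card := by
        calc (X'' \ H.image (cubeIn cube X ∘ γ)).card + 1 ≤ (X''.erase a).card + 1 := Nat.add_le_add_right (card_le_card hsub) 1
          _ = X''.card := card_erase_add_one haX
      have hc' : ((X'' \ H.image (cubeIn cube X ∘ γ)).card : ℝ) + 1 ≤ (X''.card : ℝ) := by exact_mod_cast hc
      linarith
    calc _ ≤ θ ^ ((H.card : ℝ) + β' * ((X''.card : ℝ) - 1)) := bookkeeping_nonempty_poly hθ0 hθ1 hβ hk hM0 hregN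
      _ ≤ _ := Real.rpow_le_rpow_of_exponent_ge hθ0 hθ1 (by nlinarith [hcard, hβ])

/-- **(5.14.4) LOCATED ON AN END-DECORATED CHAIN OF ANY LENGTH WITH A SOURCE, THE LETTERS (b), (c) DERIVED FROM `Δ`-LETTERS** —
`ineq5144_locAct_endChainN_source_of_decay` with (b), (c), `c₁`, `c₂`, `δ`, `ds`, the depth clause REPLACED by: a site pseudo-distance `d`, `Δ` of
range `1` in `d` with `|Δ_{xy}| ≤ h` and `≤ z` neighbours per site, a Combes–Thomas rate `μ ≥ 0` with `h z(e^μ − 1) ≤ m/2`, the summability letter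
`Σ_y e^{−μ d(x,y)} ≤ Z₀`, a unit `ℓ > 0` with the face clause `(|X″| − 2)·ℓ ≤ d(x,l)`, and the two size-free clauses with `c₁ = 2/m`, `δ = e^{−μℓ}`,
`c₂ = (2/m)·Z₀`. [cite: BalabanImbrieJaffe1988, (5.14.4) p.309–310; §5.13 p.305, p.307] [cite: CombesThomas1973, §II] -/
theorem ineq5144_locAct_endChainN_source_of_combesThomas [Fintype ι] [Fintype υ] [Nonempty α]
    (hΔ : Δ.PosDef) {m : ℝ} (hm : 0 < m) (hΔm : ∀ φ : α → ℝ, m * (φ ⬝ᵥ φ) ≤ φ ⬝ᵥ (Δ *ᵥ φ))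
    (hΦloc : ∀ b : B, ∀ φ ψ : α → ℝ, (∀ x, blk x = cube (Sum.inl b) → φ x = ψ x) → Φ b φ = Φ b ψ)
    (hVloc : ∀ Y : Ys, ∀ φ ψ : α → ℝ, (∀ x, blk x = cube (Sum.inr Y) → φ x = ψ x) → V Y φ = V Y ψ)
    (hV : ∀ Y ∈ Ys, Measurable (V Y)) {KY : υ → ℝ} (hK : ∀ Y ∈ Ys, ∀ φ, |V Y φ| ≤ KY Y)
    {K₁ : ℝ} (hK₁0 : 0 ≤ K₁) (hK₁ : ∀ Y ∈ Ys, KY Y ≤ K₁) {G : ℕ} (hG : ∀ i, (univ.filter fun τ : ↥B ⊕ ↥Ys => cube τ = i).card ≤ G)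
    {θ β' : ℝ} (hθ0 : 0 < θ) (hθ1 : θ ≤ 1) (hβ : 0 ≤ β')
    (hvac : Real.exp (2 * G * K₁) - 1 ≤ θ ^ (2 * β') / 2) (hKθ₂ : ∀ Y ∈ Ys, KY Y * Real.exp (2 * G * K₁) ≤ θ ^ (1 + β') / 2)
    {W : ℕ} (hW : ∀ i, (univ.filter fun x : α => blk x = i).card ≤ W)
    {R : ℝ} (hR0 : 0 ≤ R) (hR : ∀ x, ∑ y ∈ univ.filter (fun y => blk y ≠ blk x), |Δ x y| ≤ R)
    {F : ℝ} (hF0 : 0 ≤ F) (hF : ∀ x, |ℱ x| ≤ F)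
    (X'' : Finset I) {a b n : I} (haX : a ∈ X'') (hbX : b ∈ X'') (hnX : n ∈ X'') (hab : a ≠ b) (han : a ≠ n) (hbn : b ≠ n)
    (haV : ∀ b' : ↥B, cube (Sum.inl b') ≠ a) (hfree : ∀ τ : ↥B ⊕ ↥Ys, cube τ ∈ X'' → cube τ = a)
    (hnbr : ∀ l k, blk l ∈ X'' → blk l ≠ a → blk k = a → Δ l k ≠ 0 → blk l = b)
    -- the `Δ`-letters replacing (b) and (c): range, coupling size, neighbour count, Combes–Thomas rate, summability, unit, face clause
    (d : α → α → ℝ) (hd0 : ∀ i, d i i = 0) (hdsymm : ∀ i k, d i k = d k i) (hdtri : ∀ i j k, d i k ≤ d i j + d j k)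
    (hband : ∀ x y, 1 < d x y → Δ x y = 0) {h : ℝ} (hh0 : 0 ≤ h) (hh : ∀ x y, x ≠ y → |Δ x y| ≤ h)
    {z : ℝ} (hz : ∀ x, ((univ.filter fun y => y ≠ x ∧ d x y ≤ 1).card : ℝ) ≤ z)
    {μ : ℝ} (hμ : 0 ≤ μ) (hsmall : h * z * (Real.exp μ - 1) ≤ m / 2) {Z₀ : ℝ} (hZ : ∀ x, ∑ y, Real.exp (-(μ * d x y)) ≤ Z₀)
    {ℓ : ℝ} (hℓ : 0 < ℓ)
    (hface : ∀ x l, (blk x = n ∨ (blk x ∈ X'' ∧ ∃ y, blk y = n ∧ Δ y x ≠ 0)) → blk l = b → (∃ k, blk k = a ∧ Δ l k ≠ 0) →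
      ((X''.card : ℝ) - 2) * ℓ ≤ d x l)
    (Λc X : Finset I)
    (hreg : 4 * (W * R * ((W * (2 / m * Real.exp (-(μ * ℓ)) * R)) * ((W * (2 / m * Real.exp (-(μ * ℓ)) * R)) *
        (m⁻¹ + (2 / m * Z₀ * F) ^ 2) + 2 / m * Z₀ * F * (1 + (m⁻¹ + (2 / m * Z₀ * F) ^ 2))))) ≤ θ ^ β')
    (hstep : 2 * Real.exp (-(μ * ℓ)) ≤ θ ^ β')
    {t : ℝ} (ht0 : 0 ≤ t) (ht1 : t ≤ 1) {L : Type} [DecidableEq L] (γ : L → ↥(slotB B Ys cube X) ⊕ ↥(slotY B Ys cube X)) (H : Finset L) :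
    |locAct (cubeIn cube X ∘ γ) (actIn blk Δ ℱ adj χ p ek B Φ c Ys V cube Λc X t γ) H X''| ≤
      θ ^ ((H.card : ℝ) + β' * ((X'' \ H.image (cubeIn cube X ∘ γ)).card : ℝ)) := by
  have hdnn : ∀ x y, 0 ≤ d x y := fun x y => by linarith [hdtri x y x, hd0 x, hdsymm y x]
  have h2 : 2 ≤ X''.card := Finset.one_lt_card.2 ⟨a, haX, n, hnX, han⟩
  have hcast : (((X''.card - 2 : ℕ) : ℝ)) = (X''.card : ℝ) - 2 := by rw [Nat.cast_sub h2, Nat.cast_ofNat]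
  have hm2 : 0 ≤ 2 / m := div_nonneg (by norm_num) hm.le
  have hZ0 : 0 ≤ Z₀ := le_trans (sum_nonneg fun _ _ => (Real.exp_pos _).le) (hZ (Classical.arbitrary α))
  -- letter (c) from the decay and the summability letter
  have hrowΛ : ∀ s : I → ℝ, (∀ l, 0 ≤ s l ∧ s l ≤ 1) →
      ∀ x : In (fun x => blk x ≠ a), ∑ l, |(blkIn (fun x => blk x ≠ a) (interpForm blk (interpForm blk Δ (corner ℝ Λc)) s))⁻¹ x l| ≤
        2 / m * Z₀ := fun s hs x => by
    calc _ ≤ ∑ l : In (fun x => blk x ≠ a), 2 / m * Real.exp (-(μ * d x.1 l.1)) :=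
          sum_le_sum fun l _ => restricted_inv_decay blk d hd0 hdsymm hdtri hband hh0 hh hz hΔ hm hΔm hμ hsmall Λc hs _ x l
      _ ≤ ∑ y, 2 / m * Real.exp (-(μ * d x.1 y)) :=
          sum_subtype_le_sum (fun x => blk x ≠ a) (fun y => 2 / m * Real.exp (-(μ * d x.1 y))) fun y =>
            mul_nonneg hm2 (Real.exp_pos _).le
      _ = 2 / m * ∑ y, Real.exp (-(μ * d x.1 y)) := by rw [mul_sum]
      _ ≤ 2 / m * Z₀ := mul_le_mul_of_nonneg_left (hZ x.1) hm2
  have hrowA : ∀ s : I → ℝ, (∀ l, 0 ≤ s l ∧ s l ≤ 1) →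
      ∀ k : α, ∑ l, |(interpForm blk (interpForm blk Δ (corner ℝ Λc)) s)⁻¹ k l| ≤ 2 / m * Z₀ := fun s hs k => by
    calc _ ≤ ∑ l, 2 / m * Real.exp (-(μ * d k l)) :=
          sum_le_sum fun l _ => interp_inv_decay blk d hd0 hdsymm hdtri hband hh0 hh hz hΔ hm hΔm hμ hsmall Λc hs k l
      _ = 2 / m * ∑ l, Real.exp (-(μ * d k l)) := by rw [mul_sum]
      _ ≤ 2 / m * Z₀ := mul_le_mul_of_nonneg_left (hZ k) hm2
  exact ineq5144_locAct_endChainN_source_of_decay blk Δ ℱ adj χ p ek B Φ c Ys V cube hΔ hm hΔm hΦloc hVloc hV hK hK₁0 hK₁ hG hθ0 hθ1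
    hβ hvac hKθ₂ hW hR0 hR hF0 hF X'' haX hbX hnX hab han hbn haV hfree hnbr (fun x l => ⌊d x l / ℓ⌋₊) hm2
    (Real.exp_pos _).le (Real.exp_le_one_iff.2 (neg_nonpos.2 (mul_nonneg hμ hℓ.le)))
    (fun x l hx hl hk => (Nat.le_floor_iff (div_nonneg (hdnn x l) hℓ.le)).2
      (by rw [hcast, le_div_iff₀ hℓ]; exact hface x l hx hl hk))
    Λc X (fun s hs _ x l => restricted_inv_decay_pow blk d hd0 hdsymm hdtri hband hh0 hh hz hΔ hm hΔm hμ hsmall hℓ Λc hs _ x l)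
    (mul_nonneg hm2 hZ0) (fun s hs _ x => hrowΛ s hs x) (fun s hs _ k _ => hrowA s hs k) hreg hstep ht0 ht1 γ H

end Main

end Literature.MathematicalPhysics.QuantumFieldTheory.BalabanImbrieJaffe1984to88.BIJ88Ineq5144EndChainNSource

end
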